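import Literature.AnabelianGeometry.EtaleTheta.GalSectThm110iiiVNextKnit
import Literature.AnabelianGeometry.EtaleTheta.GalSectKxHatTorsion
import Literature.FieldTheory.AbsoluteGaloisGroupNoInvolution
import HarnessLib

/-!
# [EtTh] Thm. 1.10 (iii) — v3 END KNIT: the classical residual inputs (tf) and (μtor)×2 DISCHARGED (proof-only)

Mochizuki, *The étale theta function …* [EtTh], Publ. RIMS **45** (2009), Thm. 1.10 (iii) p. 256
[cite: MochizukiEtTh2009, Thm 1.10 (iii) p.30]; [GalSect] §4 p. 33 [cite: MochizukiGalSect2005, §4 p.33].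
abc-iut cell, layer L2, node EtTh:Thm1.10(iii), seat abc-iut-w5-d062 (gen 4); sequel of p447025
(`GalSectThm110iiiVNextKnit`, closer of record `thm110iiiGalSect_of_Xlevel_v2`).

Two of the v2 residual inputs are CLASSICAL and are now theorems of the tree:

* (tf) «`G_K` has no `2`-torsion»: `σ * σ = 1 → σ = 1` in `Gal(ℚ̄_p/ℚ_p)` — Artin–Schreier, the tree's
  `Literature.FieldTheory.AlgEquiv.eq_one_of_mul_self_eq_one_padic` (abc-iut-w6-d067, p447739); here
  `MuTwoSetting.htf`.
* (μtor) ×2 «`(K^×)^∧[2] = μ₂(K)`»: `GalSectKxHatTorsion` (`MuTwoSetting.htor`: profinite-completion torsion +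
  `[Kˣ : Kˣ²] < ∞` for the finite extension `K/ℚ_p`).

Hence:
* `MuTwoSetting.DotCCusp.hμ_of_pair` — the (μ) input «`δ(μ₂) = μ₂`» from the cusp-pair transport (b1) ALONE;
* `thm110iiiGalSect_of_genuineTorsor_v3` — v2 minus (μ): residual (b1), (gen) ×2, (b3);
* `thm110iiiGalSect_of_cuspDecompTransport_v3` — the `Π^tp_Ċ`-level transport form with the v-next FIELDS and
  (μtor) discharged: residual (x)+(ct) ×2 at the `Ċ` level, (Δ), (gen) ×2, (b3);
* `thm110_i_ii_iii_of_namedInputs_v3` — the sub-DAG NODE CLOSER (i) ∧ (ii) ∧ (iii), v3 ((μ) discharged, fields);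
* `thm110iiiGalSect_of_Xlevel_v3` — **the closer of record, v3**: residual = (x), (ct) ×2, F-0007 ([AbsAnab]
  Lem. 1.3.8 `PreservesGeom`, BY NAME), (sf) ×2, (gen) ×2 (Kummer identification of the cusp torsors), (b3)
  ([GalSect] Cor. 4.12) — every remaining input is anabelian / Kummer-origin; no classical group theory left.

PROOF-ONLY: no definitions, no named facts, no `sorry`.  HONEST FRAMING: the remaining inputs are printed
inferences / cited results carried BY NAME, none asserted; typed ≠ proved; no side taken on [IUTchIII] Cor. 3.12.
-/

namespace Literature.AnabelianGeometry.EtaleTheta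

open scoped Pointwise

open Literature.AnabelianGeometry.SemiGraphs

namespace MuTwoSetting

variable {p : ℕ} [Fact p.Prime]

/-- **(tf) discharged**: the image of `Π^tp_X` in `G_{ℚ_p}` has no involution — the binder `htf` of
`thm110iiiGalSect_of_Xlevel_twoTorsion` / `_v2` in its literal shape (Artin–Schreier at `ℚ̄_p/ℚ_p`,
abc-iut-w6-d067's `AlgEquiv.eq_one_of_mul_self_eq_one_padic`). [cite: MochizukiEtTh2009, Thm 1.10 (iii) p.30] -/
theorem htf (M : MuTwoSetting p) : ∀ x : M.PiTemp, M.aug x * M.aug x = 1 → M.aug x = 1 :=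
  fun x h => Literature.FieldTheory.AlgEquiv.eq_one_of_mul_self_eq_one_padic p (M.aug x) h

namespace DotCCusp

variable {Mα Mβ : MuTwoSetting p} {εα : Mα.GtpC} {εβ : Mβ.GtpC}

/-- **(μ) from (b1) ALONE** (v3 of `hμ_of_twoTorsion`, p443749, with (μtor) now a theorem): for cusp data whose
cusp pairs correspond under `Φ`, every homomorphism `δ` of structure groups making a class map `e` over `Φ`
equivariant carries `μ₂(Kα)` onto `μ₂(Kβ)`. [cite: MochizukiEtTh2009, Thm 1.10 (iii) p.30] -/
theorem hμ_of_pair (Cα : Mα.DotCCusp εα) (Cβ : Mβ.DotCCusp εβ) (Φ : Mα.GtpC ≃ₜ* Mβ.GtpC)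
    (hpair : Cα.pair.map Φ = Cβ.pair) {S₀ : Subgroup Mα.GtpC} (hS₀ : S₀ ∈ Cα.pair.splittings)
    (δ : GalSect.KxHat Mα.toThetaSetting.toTemperedCurve →* GalSect.KxHat Mβ.toThetaSetting.toTemperedCurve)
    (e : Cα.pair.SplittingClass → Cβ.pair.SplittingClass)
    (he : ∀ (S : Subgroup Mα.GtpC) (hS : S ∈ Cα.pair.splittings),
      ∃ h', e (GalSect.CuspPair.SplittingClass.mk Cα.pair S hS) =
        GalSect.CuspPair.SplittingClass.mk Cβ.pair (S.map Φ.toMulEquiv.toMonoidHom) h')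
    (hequiv : ∀ (k : GalSect.KxHat Mα.toThetaSetting.toTemperedCurve) (cl : Cα.pair.SplittingClass),
      e (Cα.torsor.act k cl) = Cβ.torsor.act (δ k) (e cl)) :
    Mα.muTwoHat.map δ = Mβ.muTwoHat :=
  Cα.hμ_of_twoTorsion Cβ Φ hpair hS₀ Mα.htor Mβ.htor δ e he hequiv

end DotCCusp

end MuTwoSetting

section EndKnitV3

variable {p : ℕ} [Fact p.Prime] {Mα Mβ : MuTwoSetting p} {εα : Mα.GtpC} {εβ : Mβ.GtpC}
  {hCα : Mα.toThetaSetting.Compat} {hCβ : Mβ.toThetaSetting.Compat}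
  {Eα : Mα.toThetaSetting.EtaleThetaData} {Eβ : Mβ.toThetaSetting.EtaleThetaData}
  {γ : Mα.dotC εα ≃ₜ* Mβ.dotC εβ}

/-- **v3 of the END KNIT at the genuine `H¹`-torsor**: `thm110iiiGalSect_of_genuineTorsor_v2` with its (μ) input
DISCHARGED (`hμ_of_pair`); residual = (b1) cusp-pair transport, (gen) ×2 Kummer identification, (b3); law /
`D` closed / `I ≅ Ẑ` are fields, `Π^tp_C` T1 the only side condition. [cite: MochizukiEtTh2009, Thm 1.10 (iii) p.30] -/
theorem thm110iiiGalSect_of_genuineTorsor_v3 [T1Space Mα.GtpC] [T1Space Mβ.GtpC]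
    (H : Thm110Hypothesis εα εβ hCα hCβ Eα Eβ γ)
    (Sα : Mα.StandardData Eα.toKummerData) (Sβ : Mβ.StandardData Eβ.toKummerData)
    (Cα : Mα.DotCCusp εα) (Cβ : Mβ.DotCCusp εβ)
    -- (b1)
    {c : Mβ.GtpC} (hc : c ∈ Mβ.dotC εβ)
    (hpair : Cα.pair.map (H.Γ.trans (Mβ.innerAutC c)) = Cβ.pair)
    -- (gen) ×2
    {S₀α : Subgroup Mα.GtpC} (hS₀α : S₀α ∈ Cα.pair.splittings)
    {S₀β : Subgroup Mβ.GtpC} (hS₀β : S₀β ∈ Cβ.pair.splittings)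
    (hgenα : haveI := Cα.isMulCommutative_I
      haveI := Cα.pair.ID_normal
      ∃ κ : GalSect.KxHat Mα.toThetaSetting.toTemperedCurve ≃*
          ↥(ContH1.resKer Cα.pair.ID (⊤ : Subgroup Cα.pair.D)
            (Cα.pair.isClosedComplement_of_mem_splittings hS₀α).le_left),
        ∀ k cl, Cα.torsor.act k cl = (Cα.pair.torsorDataH1 Cα.isClosed_D Cα.isCompact_I hS₀α).act (κ k) cl)
    (hgenβ : haveI := Cβ.isMulCommutative_I
      haveI := Cβ.pair.ID_normal
      ∃ κ : GalSect.KxHat Mβ.toThetaSetting.toTemperedCurve ≃*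
          ↥(ContH1.resKer Cβ.pair.ID (⊤ : Subgroup Cβ.pair.D)
            (Cβ.pair.isClosedComplement_of_mem_splittings hS₀β).le_left),
        ∀ k cl, Cβ.torsor.act k cl = (Cβ.pair.torsorDataH1 Cβ.isClosed_D Cβ.isCompact_I hS₀β).act (κ k) cl)
    -- (b3)
    (hecan : ∀ (e : Cα.pair.SplittingClass → Cβ.pair.SplittingClass),
      (∀ (S : Subgroup Mα.GtpC) (hS : S ∈ Cα.pair.splittings),
        ∃ h', e (GalSect.CuspPair.SplittingClass.mk Cα.pair S hS) =
          GalSect.CuspPair.SplittingClass.mk Cβ.pair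
            (S.map (H.Γ.trans (Mβ.innerAutC c)).toMulEquiv.toMonoidHom) h') →
      e '' Cα.canonical ⊆ Cβ.canonical) :
    Thm110iiiGalSect H Sα Sβ Cα Cβ :=
  thm110iiiGalSect_of_genuineTorsor_v2 H Sα Sβ Cα Cβ hc hpair hS₀α hS₀β hgenα hgenβ
    (fun δ e he hequiv => Cα.hμ_of_pair Cβ _ hpair hS₀α δ e he hequiv) hecan

/-- **v3 of the `Π^tp_Ċ`-level transport form** (`thm110iiiGalSect_of_cuspDecompTransport_twoTorsion`, p443938,
with the v-next FIELDS `canonical_isStructure` / `isClosed_D` / `inertia_equiv_zHat` and (μtor) DISCHARGED):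
residual = (x) the X-level cusp decomposition transport with `σ ∈ Π^tp_Ċβ`, (ct) ×2, (Δ) `Γ(Ker aug_Ċα) = Ker aug_Ċβ`,
(gen) ×2, (b3). [cite: MochizukiEtTh2009, Thm 1.10 (iii) p.30] -/
theorem thm110iiiGalSect_of_cuspDecompTransport_v3 [T1Space Mα.GtpC] [T1Space Mβ.GtpC]
    (H : Thm110Hypothesis εα εβ hCα hCβ Eα Eβ γ)
    (Sα : Mα.StandardData Eα.toKummerData) (Sβ : Mβ.StandardData Eβ.toKummerData)
    (Cα : Mα.DotCCusp εα) (Cβ : Mβ.DotCCusp εβ)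
    -- (x) + (ct) + (Δ)
    {σ : Mβ.PiTemp} (hσ : Mβ.inclX σ ∈ Mβ.dotC εβ)
    (hX : (MulAut.conj Cα.conj • Mα.decomp Cα.cusp).map H.γX.toMulEquiv.toMonoidHom =
      MulAut.conj σ • (MulAut.conj Cβ.conj • Mβ.decomp Cβ.cusp))
    (hCTα : ∀ g ∈ Mα.dotC εα, Subgroup.Commensurable (MulAut.conj g • Cα.pair.D) Cα.pair.D → g ∈ Cα.pair.D)
    (hCTβ : ∀ g ∈ Mβ.dotC εβ, Subgroup.Commensurable (MulAut.conj g • Cβ.pair.D) Cβ.pair.D → g ∈ Cβ.pair.D)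
    (hΔ : Cα.augC.ker.map H.Γ.toMulEquiv.toMonoidHom = Cβ.augC.ker)
    -- (gen) ×2
    {S₀α : Subgroup Mα.GtpC} (hS₀α : S₀α ∈ Cα.pair.splittings)
    {S₀β : Subgroup Mβ.GtpC} (hS₀β : S₀β ∈ Cβ.pair.splittings)
    (hgenα : haveI := Cα.isMulCommutative_I
      haveI := Cα.pair.ID_normal
      ∃ κ : GalSect.KxHat Mα.toThetaSetting.toTemperedCurve ≃*
          ↥(ContH1.resKer Cα.pair.ID (⊤ : Subgroup Cα.pair.D)
            (Cα.pair.isClosedComplement_of_mem_splittings hS₀α).le_left),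
        ∀ k cl, Cα.torsor.act k cl = (Cα.pair.torsorDataH1 Cα.isClosed_D Cα.isCompact_I hS₀α).act (κ k) cl)
    (hgenβ : haveI := Cβ.isMulCommutative_I
      haveI := Cβ.pair.ID_normal
      ∃ κ : GalSect.KxHat Mβ.toThetaSetting.toTemperedCurve ≃*
          ↥(ContH1.resKer Cβ.pair.ID (⊤ : Subgroup Cβ.pair.D)
            (Cβ.pair.isClosedComplement_of_mem_splittings hS₀β).le_left),
        ∀ k cl, Cβ.torsor.act k cl = (Cβ.pair.torsorDataH1 Cβ.isClosed_D Cβ.isCompact_I hS₀β).act (κ k) cl)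
    -- (b3), for the class transport along `Γ ∘ Inn c`, every `c ∈ Π^tp_{Ċβ}`
    (hecan : ∀ c ∈ Mβ.dotC εβ, ∀ (e : Cα.pair.SplittingClass → Cβ.pair.SplittingClass),
      (∀ (S : Subgroup Mα.GtpC) (hS : S ∈ Cα.pair.splittings),
        ∃ h', e (GalSect.CuspPair.SplittingClass.mk Cα.pair S hS) =
          GalSect.CuspPair.SplittingClass.mk Cβ.pair
            (S.map (H.Γ.trans (Mβ.innerAutC c)).toMulEquiv.toMonoidHom) h') →
      e '' Cα.canonical ⊆ Cβ.canonical) :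
    Thm110iiiGalSect H Sα Sβ Cα Cβ :=
  haveI := Cα.isMulCommutative_I
  haveI := Cβ.isMulCommutative_I
  thm110iiiGalSect_of_cuspDecompTransport_twoTorsion H Sα Sβ Cα Cβ Cα.isClosed_D Cα.isCompact_I
    Cβ.isClosed_D Cβ.isCompact_I Cα.canonical_isStructure hσ hX hCTα hCTβ hΔ hS₀α hS₀β hgenα hgenβ
    Mα.htor Mβ.htor hecan

/-- **THE CLOSER OF RECORD, v3 — [EtTh] Thm. 1.10 (iii) with the fully X-level residual, (tf) and (μtor)×2
DISCHARGED.**  `Thm110iiiGalSect` from: (x) the X-level cusp decomposition transport along `γ_X` (with a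
`σ ∈ Π^tp_{Ċβ}`); (ct) ×2 commensurable terminality of the cusp decomposition groups in `Π^tp_Ċ`; F-0007 =
[AbsAnab] Lem. 1.3.8 `PreservesGeom` at fundamental extensions modelling `Π_X ↠ G_K` and the completed `γ̂_X`
(BY NAME, `h138`); (sf) ×2 «`Ċ` is defined over `K`»; (gen) ×2 the Kummer identification of the two cusp
torsors with the genuine `H¹`-torsors; (b3) [GalSect] Cor. 4.12 (canonical integral structures correspond).
Law / `D` closed / `I ≅ Ẑ` are FIELDS of the cusp datum (G-w5d062-2); `Π^tp_C` T1 is the only side condition.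
[cite: MochizukiEtTh2009, Thm 1.10 (iii) p.30] -/
theorem thm110iiiGalSect_of_Xlevel_v3 [T1Space Mα.GtpC] [T1Space Mβ.GtpC]
    (H : Thm110Hypothesis εα εβ hCα hCβ Eα Eβ γ)
    (Sα : Mα.StandardData Eα.toKummerData) (Sβ : Mβ.StandardData Eβ.toKummerData)
    (Cα : Mα.DotCCusp εα) (Cβ : Mβ.DotCCusp εβ)
    -- (x) + (ct)
    {σ : Mβ.PiTemp} (hσ : Mβ.inclX σ ∈ Mβ.dotC εβ)
    (hX : (MulAut.conj Cα.conj • Mα.decomp Cα.cusp).map H.γX.toMulEquiv.toMonoidHom =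
      MulAut.conj σ • (MulAut.conj Cβ.conj • Mβ.decomp Cβ.cusp))
    (hCTα : ∀ g ∈ Mα.dotC εα, Subgroup.Commensurable (MulAut.conj g • Cα.pair.D) Cα.pair.D → g ∈ Cα.pair.D)
    (hCTβ : ∀ g ∈ Mβ.dotC εβ, Subgroup.Commensurable (MulAut.conj g • Cβ.pair.D) Cβ.pair.D → g ∈ Cβ.pair.D)
    -- (ΔX) BY NAME: [AbsAnab] Lem. 1.3.8 = FACT F-0007 `PreservesGeom`
    (Eα Eβ : Literature.AnabelianGeometry.AbsoluteAnabelian.FundamentalExtension.{0})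
    (eα : Eα.arith ≃ₜ* Mα.PiHat) (eβ : Eβ.arith ≃ₜ* Mβ.PiHat)
    (heα : Eα.geom.map eα.toMulEquiv.toMonoidHom = Mα.DeltaHat)
    (heβ : Eβ.geom.map eβ.toMulEquiv.toMonoidHom = Mβ.DeltaHat)
    (h138 : ∀ Φ : Mα.PiHat ≃ₜ* Mβ.PiHat, (∀ x : Mα.PiTemp, Φ (Mα.toHat x) = Mβ.toHat (H.γX x)) →
      Literature.AnabelianGeometry.AbsoluteAnabelian.FundamentalExtension.PreservesGeom (F := Eβ)
        (eα.trans (Φ.trans eβ.symm)))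
    -- (sf) ×2 «`Ċ` is defined over `K`»
    (hsfα : ∀ g : Mα.GtpC, ∃ h : Mα.PiTemp, Cα.augC g = Mα.aug h)
    (hsfβ : ∀ g : Mβ.GtpC, ∃ h : Mβ.PiTemp, Cβ.augC g = Mβ.aug h)
    -- (gen) ×2
    {S₀α : Subgroup Mα.GtpC} (hS₀α : S₀α ∈ Cα.pair.splittings)
    {S₀β : Subgroup Mβ.GtpC} (hS₀β : S₀β ∈ Cβ.pair.splittings)
    (hgenα : haveI := Cα.isMulCommutative_I
      haveI := Cα.pair.ID_normal
      ∃ κ : GalSect.KxHat Mα.toThetaSetting.toTemperedCurve ≃*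
          ↥(ContH1.resKer Cα.pair.ID (⊤ : Subgroup Cα.pair.D)
            (Cα.pair.isClosedComplement_of_mem_splittings hS₀α).le_left),
        ∀ k cl, Cα.torsor.act k cl = (Cα.pair.torsorDataH1 Cα.isClosed_D Cα.isCompact_I hS₀α).act (κ k) cl)
    (hgenβ : haveI := Cβ.isMulCommutative_I
      haveI := Cβ.pair.ID_normal
      ∃ κ : GalSect.KxHat Mβ.toThetaSetting.toTemperedCurve ≃*
          ↥(ContH1.resKer Cβ.pair.ID (⊤ : Subgroup Cβ.pair.D)
            (Cβ.pair.isClosedComplement_of_mem_splittings hS₀β).le_left),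
        ∀ k cl, Cβ.torsor.act k cl = (Cβ.pair.torsorDataH1 Cβ.isClosed_D Cβ.isCompact_I hS₀β).act (κ k) cl)
    -- (b3)
    (hecan : ∀ c ∈ Mβ.dotC εβ, ∀ (e : Cα.pair.SplittingClass → Cβ.pair.SplittingClass),
      (∀ (S : Subgroup Mα.GtpC) (hS : S ∈ Cα.pair.splittings),
        ∃ h', e (GalSect.CuspPair.SplittingClass.mk Cα.pair S hS) =
          GalSect.CuspPair.SplittingClass.mk Cβ.pair
            (S.map (H.Γ.trans (Mβ.innerAutC c)).toMulEquiv.toMonoidHom) h') →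
      e '' Cα.canonical ⊆ Cβ.canonical) :
    Thm110iiiGalSect H Sα Sβ Cα Cβ :=
  thm110iiiGalSect_of_Xlevel_v2 H Sα Sβ Cα Cβ hσ hX hCTα hCTβ Eα Eβ eα eβ heα heβ h138 hsfα hsfβ Mβ.htf
    hS₀α hS₀β hgenα hgenβ Mα.htor Mβ.htor hecan

/-- **The sub-DAG NODE CLOSER, v3 — [EtTh] Thm. 1.10 (i) ∧ (ii) ∧ (iii) from NAMED inputs** (v3 of p435878's
`thm110_i_ii_iii_of_namedInputs`): (i)/(ii) binders verbatim (abc-iut-w5-d140's K2 closers from `Prop15ii` ×2,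
`δ̈` with `Thm110DeltaInduced` / `Thm110DeltaCompat`, the typed row r5 `Thm110DecompTransport`, the two deck
relations); (iii) by `thm110iiiGalSect_of_genuineTorsor_v3` from {(b1), (gen) ×2, (b3)} — law / topological
clauses are FIELDS, (μ) is DISCHARGED. [cite: MochizukiEtTh2009, Thm 1.10 p.30] -/
theorem thm110_i_ii_iii_of_namedInputs_v3 [T1Space Mα.GtpC] [T1Space Mβ.GtpC]
    (H : Thm110Hypothesis εα εβ hCα hCβ Eα Eβ γ)
    (Aα : Mα.AnchoredStandardData Eα.toKummerData) (Aβ : Mβ.AnchoredStandardData Eβ.toKummerData)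
    -- inputs of (i)/(ii) (K2)
    (h15iiα : ThetaSetting.Prop15ii Eα.toKummerData hCα)
    (h15iiβ : ThetaSetting.Prop15ii Eβ.toKummerData hCβ)
    (δdd : (↥Mα.Kdd)ˣ ≃* (↥Mβ.Kdd)ˣ) (hδdd : Thm110DeltaInduced H δdd)
    (hcompat : Thm110DeltaCompat (Mα := Mα) (Mβ := Mβ) δdd)
    (hτ : Thm110DecompTransport H Aα.toStandardData Aβ.toStandardData)
    {eα : Mα.PiTemp} (heα : Mα.toZ eα = 1)
    (hDτα : Aα.tauInv.Dpt = Aα.tau.Dpt.comap (MulAut.conj eα).toMonoidHom)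
    {eβ : Mβ.PiTemp} (heβ : Mβ.toZ eβ = 1)
    (hDτβ : Aβ.tauInv.Dpt = Aβ.tau.Dpt.comap (MulAut.conj eβ).toMonoidHom)
    -- inputs of (iii): (b1), (gen) ×2, (b3)
    (Cα : Mα.DotCCusp εα) (Cβ : Mβ.DotCCusp εβ)
    {c : Mβ.GtpC} (hc : c ∈ Mβ.dotC εβ)
    (hpair : Cα.pair.map (H.Γ.trans (Mβ.innerAutC c)) = Cβ.pair)
    {S₀α : Subgroup Mα.GtpC} (hS₀α : S₀α ∈ Cα.pair.splittings)
    {S₀β : Subgroup Mβ.GtpC} (hS₀β : S₀β ∈ Cβ.pair.splittings)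
    (hgenα : haveI := Cα.isMulCommutative_I
      haveI := Cα.pair.ID_normal
      ∃ κ : GalSect.KxHat Mα.toThetaSetting.toTemperedCurve ≃*
          ↥(ContH1.resKer Cα.pair.ID (⊤ : Subgroup Cα.pair.D)
            (Cα.pair.isClosedComplement_of_mem_splittings hS₀α).le_left),
        ∀ k cl, Cα.torsor.act k cl = (Cα.pair.torsorDataH1 Cα.isClosed_D Cα.isCompact_I hS₀α).act (κ k) cl)
    (hgenβ : haveI := Cβ.isMulCommutative_I
      haveI := Cβ.pair.ID_normal
      ∃ κ : GalSect.KxHat Mβ.toThetaSetting.toTemperedCurve ≃*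
          ↥(ContH1.resKer Cβ.pair.ID (⊤ : Subgroup Cβ.pair.D)
            (Cβ.pair.isClosedComplement_of_mem_splittings hS₀β).le_left),
        ∀ k cl, Cβ.torsor.act k cl = (Cβ.pair.torsorDataH1 Cβ.isClosed_D Cβ.isCompact_I hS₀β).act (κ k) cl)
    (hecan : ∀ (e : Cα.pair.SplittingClass → Cβ.pair.SplittingClass),
      (∀ (S : Subgroup Mα.GtpC) (hS : S ∈ Cα.pair.splittings),
        ∃ h', e (GalSect.CuspPair.SplittingClass.mk Cα.pair S hS) =
          GalSect.CuspPair.SplittingClass.mk Cβ.pair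
            (S.map (H.Γ.trans (Mβ.innerAutC c)).toMulEquiv.toMonoidHom) h') →
      e '' Cα.canonical ⊆ Cβ.canonical) :
    Thm110i H Aα.toStandardData Aβ.toStandardData ∧ Thm110ii H Aα.toStandardData Aβ.toStandardData ∧
      Thm110iiiGalSect H Aα.toStandardData Aβ.toStandardData Cα Cβ :=
  ⟨thm110i_of_decompTransport_of_deck H Aα Aβ h15iiα h15iiβ δdd hδdd hcompat hτ heα hDτα heβ hDτβ,
    thm110ii_of_decompTransport_of_deck H Aα Aβ h15iiα h15iiβ δdd hδdd hτ heα hDτα heβ hDτβ,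
    thm110iiiGalSect_of_genuineTorsor_v3 H Aα.toStandardData Aβ.toStandardData Cα Cβ hc hpair hS₀α hS₀β
      hgenα hgenβ hecan⟩

end EndKnitV3

end Literature.AnabelianGeometry.EtaleTheta
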